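import Summits.BirchSwinnertonDyer.BirchSwinnertonDyer.Theses.TwoAdicConverse
import Summits.BirchSwinnertonDyer.BirchSwinnertonDyer.Theorems.TwoAdicConverseLambdaHalfBridge
import HarnessLib

/-!
# Route `TwoAdicConverse` (rung S3): the GLUE item `GoodOrdinaryRankZeroTwoConverseOfLambdaHalf` — PROVED

Cell `bsd-2adic` (run/shared/lean/pub/bsd-2adic/), seat `bsd-2adic-conv-1` (GEN 3). After the director's ruling
(2026-08-26T08:01Z) the planner re-split item 19218 `GoodOrdinaryRankZeroTwoConverse` (route rev 8–11):
PUBLISHED inputs (`OrdConversePublishedInputsAtTwo`, item 19167) ∧ the `λ`-HALF of the `2`-adic main conjecture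
(`OrdLambdaHalfAtTwo`, item 19556, written out; definitionally conv-1's closed leaf
`Theorems.TwoAdicTwistConverse.OrdLambdaHalfAtTwo`, p425465) ⟹ the parent, through the glue item
`GoodOrdinaryRankZeroTwoConverseOfLambdaHalf` (item 19557). This file is that glue item's proof: ONE application of
conv-1's bridge `goodOrdinaryRankZeroTwoConverse_of_ordLambdaHalfAtTwo` (p427789; = p424885's
`goodOrdinaryRankZeroTwoConverse_of_forall_lam_le` with the leaf's ordinary guard discharged by `GoodOrd W 2`). The
theorem's TYPE is literally the route decl. Nothing else is claimed: the crux `OrdLambdaHalfAtTwo` (19556) stays OPEN;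
BSD is not proved by any of this. PARTITION (D-0054): none — RANK axis (S3); companion formula cell X5@2 good-ord
(B1·O1; 611 classes), owner bsd-2adic.
-/

set_option linter.dupNamespace false
set_option autoImplicit false

namespace Summit.BirchSwinnertonDyer.BirchSwinnertonDyer.Theorems

/-- **GLUE (item stmt-BirchSwinnertonDyer-19557): PUBLISHED inputs ∧ the `λ`-half ⟹ `GoodOrdinaryRankZeroTwoConverse`.**
For every non-CM `E/ℚ` good ordinary at `2`: `Sel_{2^∞}(E/ℚ)` finite ⇒ `f_X(0) ≠ 0` (Greenberg Thm. 4.1 AT `2`,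
parity-free) ⇒ `L₀(0) ≠ 0` (Kato 17.4 (1)(2) AT `2` + the ONE inequality `λ(L₀) ≤ λ(X)`: the pinch at `T = 0`,
p424885 §1–§2) ⇒ `L(E,1) ≠ 0` (interpolation, `α ≠ 1`). One application of
`TwoAdicTwistConverse.goodOrdinaryRankZeroTwoConverse_of_ordLambdaHalfAtTwo` (p427789); the route decls unfold
definitionally to its hypotheses. [cite: GreenbergLNM1716, Thm. 4.1 (p. 102)] [cite: Kato2004Asterisque, Thm. 17.4 (1)(2) (p. 273)]
[cite: GreenbergVatsal2000, p. 4 (after Thm. (1.2))] -/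
theorem goodOrdinaryRankZeroTwoConverseOfLambdaHalf_proof :
    Summit.BirchSwinnertonDyer.BirchSwinnertonDyer.Theses.TwoAdicConverse.GoodOrdinaryRankZeroTwoConverseOfLambdaHalf := by
  intro hP hL
  exact TwoAdicTwistConverse.goodOrdinaryRankZeroTwoConverse_of_ordLambdaHalfAtTwo hP hL

end Summit.BirchSwinnertonDyer.BirchSwinnertonDyer.Theorems
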